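import Literature.Probability.Percolation.SitePaths
import Literature.Probability.LatticeModels.StarCrossing
import HarnessLib

/-!
# PCINT lane, king route, K1 step (1): the two-layer ("pair") structure of the matching lattice `ℤ²∗`

Cell `prim-pcint`, seat `prim-pcint-1` (gen 9); memo `run/shared/lean/prim/pcint/KING-ROUTE.md` §K1.

Menshikov–Pelikh / van den Berg–Ermakov (Random Struct. Alg. 8 (1996), §2 and Fig. 1(c),(d)) view the
matching lattice `S∗ = ℤ²∗` (minus every other horizontal edge) as the two-layer lattice `𝕃` over the
square lattice `S = ℤ²`.  Concretely (our coordinates): the PAIR of `v = (v₀, v₁) ∈ ℤ²` consists of the two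
`∗`-adjacent sites

  `pairSite v false = (v₀ + v₁, v₀ - v₁)` ("bottom") and `pairSite v true = (v₀ + v₁ + 1, v₀ - v₁)` ("top")

of `ℤ²∗` (the even sublattice and its translate by `e₀`; `v ↦ pairSite v i` is injective and the pairs
tile `ℤ²`).  For `S`-neighbours `v ∼ w` with `w = v + e₀` or `w = v + e₁` (so `v` is the endpoint with the
smaller coordinate sum, "min") the three site pairs bottom–bottom, top–top and top(min)–bottom(max) are
`∗`-adjacent (`pairSite_adj_bb/tt/tb`); this is vdBE's "`ε`-adjacency" (§3): with
`ε(v) = (bottom open, top open)`, `v` and `w` are `ε`-adjacent iff one of these three pairs is open–open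
(`EtaAdj`).  Consequently (`exists_pathIn_of_etaChain`) a chain `v₀, v₁, …, v_k` of consecutive
`S`-neighbours that are `ε`-adjacent in an `ℤ²∗`-site configuration `ω` yields an OPEN `∗`-PATH in `ω` from an
open site of the pair of `v₀` to an open site of the pair of `v_k` (within a pair both sites, when open, are
joined by the rung `pairSite_adj_rung`).  This is the deterministic half of "`θ_𝕃(p) > 0 ⇒ θ_{S∗}(p) > 0`".
-/

noncomputable section

namespace Summit.CriticalPhenomena.PercolationContinuityZ3.Theorems.Pcint

open Literature.Probability.Percolation Literature.Probability.LatticeModels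

namespace KingPairs

/-- The two sites of `ℤ²∗` forming the pair of `v ∈ ℤ²`: `(v₀ + v₁ + [i], v₀ - v₁)`. -/
def pairSite (v : Site 2) (i : Bool) : Site 2 := ![v 0 + v 1 + (if i then 1 else 0), v 0 - v 1]

/-- First coordinate of a pair site. -/
@[simp] theorem pairSite_apply_zero (v : Site 2) (i : Bool) :
    pairSite v i 0 = v 0 + v 1 + (if i then 1 else 0) := rfl

/-- Second coordinate of a pair site. -/
@[simp] theorem pairSite_apply_one (v : Site 2) (i : Bool) : pairSite v i 1 = v 0 - v 1 := rfl

/-- **The pair map is injective**: a site of `ℤ²∗` belongs to exactly one pair, in one layer. -/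
theorem pairSite_injective : Function.Injective (fun z : Site 2 × Bool => pairSite z.1 z.2) := by
  rintro ⟨v, i⟩ ⟨w, j⟩ h
  have h0 := congrFun h 0
  have h1 := congrFun h 1
  simp only [pairSite_apply_zero, pairSite_apply_one] at h0 h1
  have hij : i = j := by
    cases i <;> cases j <;> simp at h0 ⊢ <;> omega
  subst hij
  have hv0 : v 0 = w 0 := by cases i <;> simp at h0 <;> omega
  have hv1 : v 1 = w 1 := by cases i <;> simp at h0 <;> omega
  simp only [Prod.mk.injEq, and_true]
  ext k; fin_cases k
  · exact hv0
  · exact hv1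

/-- **The rung**: the two sites of a pair are `∗`-adjacent. -/
theorem pairSite_adj_rung (v : Site 2) : zdStarGraph.Adj (pairSite v false) (pairSite v true) := by
  rw [zdStarGraph_adj_iff]
  simp only [pairSite_apply_zero, pairSite_apply_one]
  refine ⟨Or.inl (by simp), ?_, ?_⟩ <;> rw [abs_le] <;> constructor <;> simp

/-- The two kinds of oriented `S`-edges `v → v + eᵢ` (`v` = the endpoint with the smaller coordinate sum). -/
theorem eq_add_single_of_adj {v w : Site 2} (h : (zdGraph 2).Adj v w) :
    (∃ i : Fin 2, w = v + Pi.single i 1) ∨ (∃ i : Fin 2, v = w + Pi.single i 1) := by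
  obtain ⟨i, hi | hi⟩ := (zdGraph_adj_iff _ _).1 h
  · exact Or.inl ⟨i, hi⟩
  · exact Or.inr ⟨i, hi⟩

/-- Bottom–bottom sites of the pairs of `v` and `v + eᵢ` are `∗`-adjacent. -/
theorem pairSite_adj_bb (v : Site 2) (i : Fin 2) :
    zdStarGraph.Adj (pairSite v false) (pairSite (v + Pi.single i 1) false) := by
  rw [zdStarGraph_adj_iff]
  fin_cases i <;>
    simp only [pairSite_apply_zero, pairSite_apply_one, Pi.add_apply, Fin.zero_eta, Fin.mk_one, Fin.isValue,
      Pi.single_eq_same, Pi.single_eq_of_ne (show (1 : Fin 2) ≠ 0 by decide),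
      Pi.single_eq_of_ne (show (0 : Fin 2) ≠ 1 by decide), Bool.false_eq_true, if_false, abs_le] <;>
    omega

/-- Top–top sites of the pairs of `v` and `v + eᵢ` are `∗`-adjacent. -/
theorem pairSite_adj_tt (v : Site 2) (i : Fin 2) :
    zdStarGraph.Adj (pairSite v true) (pairSite (v + Pi.single i 1) true) := by
  rw [zdStarGraph_adj_iff]
  fin_cases i <;>
    simp only [pairSite_apply_zero, pairSite_apply_one, Pi.add_apply, Fin.zero_eta, Fin.mk_one, Fin.isValue,
      Pi.single_eq_same, Pi.single_eq_of_ne (show (1 : Fin 2) ≠ 0 by decide),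
      Pi.single_eq_of_ne (show (0 : Fin 2) ≠ 1 by decide), if_true, abs_le] <;>
    omega

/-- The diagonal of `𝕃`: the top site of the pair of `v` ("min") and the bottom site of the pair of
`v + eᵢ` ("max") are `∗`-adjacent. -/
theorem pairSite_adj_tb (v : Site 2) (i : Fin 2) :
    zdStarGraph.Adj (pairSite v true) (pairSite (v + Pi.single i 1) false) := by
  rw [zdStarGraph_adj_iff]
  fin_cases i <;>
    simp only [pairSite_apply_zero, pairSite_apply_one, Pi.add_apply, Fin.zero_eta, Fin.mk_one, Fin.isValue,
      Pi.single_eq_same, Pi.single_eq_of_ne (show (1 : Fin 2) ≠ 0 by decide),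
      Pi.single_eq_of_ne (show (0 : Fin 2) ≠ 1 by decide), Bool.false_eq_true, if_false, if_true, abs_le] <;>
    omega

/-- **`ε`-adjacency of an oriented edge `v → v + eᵢ`** in the `ℤ²∗`-site configuration `ω`
(van den Berg–Ermakov §3): bottom–bottom, top–top or top(`v`)–bottom(`v + eᵢ`) open–open. -/
def EtaAdjOr (ω : Set (Site 2)) (v w : Site 2) : Prop :=
  (pairSite v false ∈ ω ∧ pairSite w false ∈ ω) ∨ (pairSite v true ∈ ω ∧ pairSite w true ∈ ω) ∨
    (pairSite v true ∈ ω ∧ pairSite w false ∈ ω)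

/-- **`ε`-adjacency of `S`-neighbours** (symmetric form): the edge oriented from the endpoint with the
smaller coordinate sum; for non-neighbours, `False`. -/
def EtaAdj (ω : Set (Site 2)) (v w : Site 2) : Prop :=
  ((∃ i : Fin 2, w = v + Pi.single i 1) ∧ EtaAdjOr ω v w) ∨ ((∃ i : Fin 2, v = w + Pi.single i 1) ∧ EtaAdjOr ω w v)

/-- `ε`-adjacency is symmetric. -/
theorem etaAdj_comm {ω : Set (Site 2)} {v w : Site 2} : EtaAdj ω v w ↔ EtaAdj ω w v := by
  unfold EtaAdj; tauto

/-- **`ε`-adjacent neighbours have `∗`-adjacent open pair sites** (oriented form). -/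
theorem exists_adj_open_of_etaAdjOr {ω : Set (Site 2)} {v : Site 2} {i : Fin 2}
    (h : EtaAdjOr ω v (v + Pi.single i 1)) :
    ∃ a b : Bool, pairSite v a ∈ ω ∧ pairSite (v + Pi.single i 1) b ∈ ω ∧
      zdStarGraph.Adj (pairSite v a) (pairSite (v + Pi.single i 1) b) := by
  rcases h with ⟨h1, h2⟩ | ⟨h1, h2⟩ | ⟨h1, h2⟩
  · exact ⟨false, false, h1, h2, pairSite_adj_bb v i⟩
  · exact ⟨true, true, h1, h2, pairSite_adj_tt v i⟩
  · exact ⟨true, false, h1, h2, pairSite_adj_tb v i⟩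

/-- **`ε`-adjacent neighbours have `∗`-adjacent open pair sites.** -/
theorem exists_adj_open_of_etaAdj {ω : Set (Site 2)} {v w : Site 2} (h : EtaAdj ω v w) :
    ∃ a b : Bool, pairSite v a ∈ ω ∧ pairSite w b ∈ ω ∧ zdStarGraph.Adj (pairSite v a) (pairSite w b) := by
  rcases h with ⟨⟨i, rfl⟩, h⟩ | ⟨⟨i, rfl⟩, h⟩
  · exact exists_adj_open_of_etaAdjOr h
  · obtain ⟨a, b, ha, hb, hadj⟩ := exists_adj_open_of_etaAdjOr h
    exact ⟨b, a, hb, ha, hadj.symm⟩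

/-- Within a pair, an open site is joined inside `ω` to every open site of the same pair (by the rung). -/
theorem pathIn_pair {ω : Set (Site 2)} {v : Site 2} {a b : Bool} (ha : pairSite v a ∈ ω) (hb : pairSite v b ∈ ω) :
    PathIn zdStarGraph ω (pairSite v a) (pairSite v b) := by
  cases a <;> cases b
  · exact PathIn.refl ha
  · exact PathIn.of_adj ha hb (pairSite_adj_rung v)
  · exact PathIn.of_adj ha hb (pairSite_adj_rung v).symm
  · exact PathIn.refl ha

/-- **An `ε`-chain yields an open `∗`-path** (vdBE §3: "the occurrence of an infinite `ε`-connected cluster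
on `S` [gives] an infinite open cluster on `𝕃`", and `𝕃 ⊆ S∗`): if consecutive vertices of the list
`v₀ :: l` are `ε`-adjacent in `ω`, then for every open site `x` of the pair of `v₀` and every open site `y`
of the pair of the last vertex there is a `∗`-path of open sites of `ω` from `x` to `y`. -/
theorem exists_pathIn_of_etaChain {ω : Set (Site 2)} :
    ∀ (l : List (Site 2)) (v₀ : Site 2), List.IsChain (EtaAdj ω) (v₀ :: l) →
      ∀ (a b : Bool), pairSite v₀ a ∈ ω → pairSite ((v₀ :: l).getLast (List.cons_ne_nil _ _)) b ∈ ω →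
        PathIn zdStarGraph ω (pairSite v₀ a) (pairSite ((v₀ :: l).getLast (List.cons_ne_nil _ _)) b)
  | [], v₀, _, a, b, ha, hb => by simpa using pathIn_pair ha hb
  | w :: l, v₀, hc, a, b, ha, hb => by
    have hvw : EtaAdj ω v₀ w := (List.isChain_cons_cons.1 hc).1
    have hc' : List.IsChain (EtaAdj ω) (w :: l) := (List.isChain_cons_cons.1 hc).2
    obtain ⟨a', b', ha', hb', hadj⟩ := exists_adj_open_of_etaAdj hvw
    have hlast : (v₀ :: w :: l).getLast (List.cons_ne_nil _ _) = (w :: l).getLast (List.cons_ne_nil _ _) := by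
      simp [List.getLast_cons]
    rw [hlast] at hb ⊢
    exact ((pathIn_pair ha ha').trans (PathIn.of_adj ha' hb' hadj)).trans
      (exists_pathIn_of_etaChain l w hc' b' b hb' hb)

/-- **Pairs far from the origin have sites far from the origin**: `|v_k| ≤ max (|s₀|, |s₁|)` for both sites
`s` of the pair of `v` (`2 v₀ = s₀ - [i] + s₁`, `2 v₁ = s₀ - [i] - s₁`); used to turn "the `ε`-cluster reaches
`∂B(n)`" into "the open `∗`-cluster reaches sup-distance `n`". -/
theorem abs_le_pairSite_norm (v : Site 2) (i : Bool) (k : Fin 2) :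
    |v k| ≤ max |pairSite v i 0| |pairSite v i 1| := by
  have h1 : |pairSite v i 0| ≤ max |pairSite v i 0| |pairSite v i 1| := le_max_left _ _
  have h2 : |pairSite v i 1| ≤ max |pairSite v i 0| |pairSite v i 1| := le_max_right _ _
  set M := max |pairSite v i 0| |pairSite v i 1| with hM
  simp only [pairSite_apply_zero, pairSite_apply_one] at h1 h2
  rw [abs_le] at h1 h2 ⊢
  fin_cases k <;> cases i <;>
    simp only [Bool.false_eq_true, if_false, if_true, add_zero, Fin.zero_eta, Fin.mk_one, Fin.isValue] at h1 h2 ⊢ <;>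
    omega

end KingPairs

end Summit.CriticalPhenomena.PercolationContinuityZ3.Theorems.Pcint

end
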